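import Literature.NumberTheory.Transcendental.BakerLogarithmsConclusion
import Literature.NumberTheory.Transcendental.QuadraticRelationsLogarithmsProofs
import HarnessLib

/-!
# Quadratic relations between logarithms: the cases covered by Baker's theorem (PROVED)

Topic `Literature/NumberTheory/Transcendental`; third proofs-only sibling of
`QuadraticRelationsLogarithms.lean` (named facts
`Literature.NumberTheory.Transcendental.royWaldschmidt_quadratic_thm_0_2` = Roy–Waldschmidt 1997,
Théorème 0.2, and `Literature.NumberTheory.Transcendental.royWaldschmidt_quadraticForm_ne_zero_of_trdeg_one`
= the Résumé corollary: a non-zero quadratic form `Q ∈ ℚ[X₁,…,Xₙ]` does not vanish at a point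
`λ ∈ 𝓛ⁿ` with `ℚ`-linearly independent coordinates generating a field of transcendence degree `1`),
after `…Proofs.lean` (Résumé ⇐ Théorème 0.2) and `…BWProofs.lean` (the cases of the Résumé
corollary that follow from the theorem of Brownawell and Waldschmidt: the split forms
`X₀X₃ − X₁X₂`, `X₁² − X₀X₂`).

This file PROVES the cases of the Résumé corollary that follow from **Baker's theorem** (Baker
1975, Thm. 2.1, a THEOREM of the tree: `Literature.NumberTheory.Transcendental.baker_holds`):
if `λ₁, …, λₙ` are `ℚ`-linearly independent logarithms of algebraic numbers then `1, λ₁, …, λₙ`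
are linearly independent over `ℚ̄`, so NO transcendence-degree hypothesis is needed for

* `RoyWaldschmidt1997.eq_zero_of_sum_algebraic_mul_eq_zero` — `∑ aᵢλᵢ = 0` with algebraic `aᵢ`
  forces `a = 0` (the homogeneous case of Baker's theorem);
* `RoyWaldschmidt1997.aeval_ne_zero_of_split` — **`Q(λ) ≠ 0` for every non-zero `Q ∈ ℚ[X]` that
  splits over `ℚ̄` as a product of two linear forms** (`Q(z) = (∑ aᵢzᵢ)(∑ bᵢzᵢ)` with algebraic
  `aᵢ, bᵢ`), i.e. for all quadratic forms of rank `≤ 2`;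
* `RoyWaldschmidt1997.exists_split_of_le_two` — every quadratic form in `≤ 2` variables over `ℚ`
  splits over `ℚ̄` (the roots of `pt² + qt + r`);
* `RoyWaldschmidt1997.quadraticForm_ne_zero_of_le_two` — hence **the Résumé corollary for
  `n ≤ 2`, unconditionally** (for `n = 2` this is the Gelfond–Schneider theorem in Baker's form
  "`β₁ log α₁ + β₂ log α₂ ≠ 0`", Baker 1975, Ch. 2 §1), and
  `RoyWaldschmidt1997.royWaldschmidt_quadraticForm_ne_zero_of_trdeg_one_of_le_two`, the literal
  instance `n ≤ 2` of the named fact.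

State of the Résumé corollary in the tree after this file: PROVED for all forms of rank `≤ 2`
(here), for the split ternary/quaternary models `X₁² − X₀X₂`, `X₀X₃ − X₁X₂` in transcendence
degree `1` (`…BWProofs.lean`), and in general CONDITIONALLY on Théorème 0.2
(`royWaldschmidt_quadraticForm_ne_zero_of_trdeg_one_of_thm_0_2`, `…Proofs.lean`); the first case
not covered by classical results is an anisotropic ternary form such as `X₀² + X₁² + X₂²`, which is
the genuinely new content of Roy–Waldschmidt's Théorème 0.2 (op. cit., Introduction, p. 754).
No definitions, no named facts (D-0026).

## References

* [RoyWaldschmidt1997ENS] D. Roy, M. Waldschmidt, *Approximation diophantienne et indépendance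
  algébrique de logarithmes*, Ann. Sci. ÉNS (4) 30 (1997) 753–796: Résumé p. 753, Introduction
  p. 754, Théorème 0.2 p. 755 (lit key paper:doi-10-1016-s0012-9593-97-89938-7, PDF pp. 2–4).
* [Baker1975] A. Baker, *Transcendental Number Theory*, Cambridge Univ. Press 1975, Ch. 2,
  Thm. 2.1 (p. 10 of the book; tree: `baker_holds`, `BakerLogarithmsConclusion.lean`) and §1
  (the Gelfond–Schneider theorem as the case of two logarithms).
-/

noncomputable section

open Complex MvPolynomial

namespace Literature.NumberTheory.Transcendental

namespace RoyWaldschmidt1997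

variable {n : ℕ}

/-! ### Baker's theorem: no algebraic linear relation between `ℚ`-independent logarithms -/

/-- **Baker's theorem, homogeneous form.** `ℚ`-linearly independent logarithms of algebraic
numbers are linearly independent over `ℚ̄ = algebraicClosure ℚ ℂ` (drop the vector `1` from
`baker_holds`). [cite: Baker1975, Thm 2.1] -/
theorem linearIndependent_algebraicClosure {l : Fin n → ℂ}
    (hl : ∀ i, IsAlgebraic ℚ (cexp (l i))) (hli : LinearIndependent ℚ l) :
    LinearIndependent (algebraicClosure ℚ ℂ) l := by
  have h := baker_holds l hl hli
  exact h.comp some (Option.some_injective _)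

/-- **No algebraic linear relation** (Baker): if `∑ aᵢ λᵢ = 0` with all `aᵢ` algebraic and the
`λᵢ` `ℚ`-linearly independent logarithms of algebraic numbers, then `a = 0`.
[cite: Baker1975, Thm 2.1] -/
theorem eq_zero_of_sum_algebraic_mul_eq_zero {l : Fin n → ℂ}
    (hl : ∀ i, IsAlgebraic ℚ (cexp (l i))) (hli : LinearIndependent ℚ l) {a : Fin n → ℂ}
    (ha : ∀ i, IsAlgebraic ℚ (a i)) (h : ∑ i, a i * l i = 0) : a = 0 := by
  have hB := linearIndependent_algebraicClosure hl hli
  have ha' : ∀ i, a i ∈ algebraicClosure ℚ ℂ := fun i => mem_algebraicClosure_iff.2 (ha i)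
  have h0 := Fintype.linearIndependent_iff.mp hB (fun i => ⟨a i, ha' i⟩) (by
    simpa [IntermediateField.smul_def, smul_eq_mul] using h)
  funext i
  simpa using congrArg Subtype.val (h0 i)

/-! ### Split forms (rank `≤ 2`) -/

/-- **The Résumé corollary for split forms, from Baker's theorem.** Let `λ₁, …, λₙ` be
`ℚ`-linearly independent logarithms of algebraic numbers and let `Q ∈ ℚ[X₁, …, Xₙ]`, `Q ≠ 0`,
split over `ℚ̄` as a product of two linear forms: `Q(z) = (∑ aᵢ zᵢ)(∑ bᵢ zᵢ)` for all `z ∈ ℂⁿ`,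
with algebraic `aᵢ, bᵢ`. Then `Q(λ) ≠ 0` — with no hypothesis on the transcendence degree: a
vanishing factor is an algebraic linear relation, so `a = 0` or `b = 0` by Baker's theorem, and
then `Q` vanishes identically, i.e. `Q = 0`. [cite: Baker1975, Thm 2.1]
[cite: RoyWaldschmidt1997ENS, Résumé p. 753] -/
theorem aeval_ne_zero_of_split {l : Fin n → ℂ}
    (hl : ∀ i, IsAlgebraic ℚ (cexp (l i))) (hli : LinearIndependent ℚ l)
    {Q : MvPolynomial (Fin n) ℚ} (hQ : Q ≠ 0) {a b : Fin n → ℂ}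
    (ha : ∀ i, IsAlgebraic ℚ (a i)) (hb : ∀ i, IsAlgebraic ℚ (b i))
    (hQab : ∀ z : Fin n → ℂ, aeval z Q = (∑ i, a i * z i) * (∑ i, b i * z i)) :
    aeval l Q ≠ 0 := by
  intro h0
  rw [hQab] at h0
  apply hQ
  refine eq_zero_of_forall_aeval_cast_eq_zero fun w => ?_
  rw [hQab]
  rcases mul_eq_zero.mp h0 with h | h
  · rw [eq_zero_of_sum_algebraic_mul_eq_zero hl hli ha h]
    simp
  · rw [eq_zero_of_sum_algebraic_mul_eq_zero hl hli hb h]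
    simp

/-! ### Quadratic forms in at most two variables split over `ℚ̄` -/

/-- Evaluation of a polynomial over `ℚ` at a complex point, as a sum over its support.
[folklore] -/
theorem aeval_eq_sum_support (Q : MvPolynomial (Fin n) ℚ) (z : Fin n → ℂ) :
    aeval z Q = ∑ d ∈ Q.support, ((Q.coeff d : ℚ) : ℂ) * ∏ i, z i ^ d i := by
  rw [MvPolynomial.aeval_def, MvPolynomial.eval₂_eq']
  simp

/-- The exponent vectors in the support of a quadratic form have degree `2`. [folklore] -/
theorem degree_eq_two_of_mem_support {Q : MvPolynomial (Fin n) ℚ} (hQ : Q.IsHomogeneous 2)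
    {d : Fin n →₀ ℕ} (hd : d ∈ Q.support) : d.degree = 2 := by
  by_contra h
  exact (mem_support_iff.mp hd) (hQ.coeff_eq_zero h)

/-- A quadratic form in no variable is zero. [folklore] -/
theorem eq_zero_of_isHomogeneous_two_zero (Q : MvPolynomial (Fin 0) ℚ) (hQ : Q.IsHomogeneous 2) :
    Q = 0 := by
  by_contra h
  obtain ⟨d, hd⟩ := MvPolynomial.ne_zero_iff.mp h
  have h2 := degree_eq_two_of_mem_support hQ (mem_support_iff.mpr hd)
  rw [Finsupp.degree_eq_sum] at h2
  simp at h2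

/-- Exponent vectors of degree `2` in one variable. [folklore] -/
theorem finsupp_fin_one_of_degree_two {d : Fin 1 →₀ ℕ} (hd : d.degree = 2) :
    d = Finsupp.single 0 2 := by
  rw [Finsupp.degree_eq_sum, Fin.sum_univ_one] at hd
  refine Finsupp.ext fun i => ?_
  fin_cases i
  simpa using hd

/-- Exponent vectors of degree `2` in two variables: `(2,0)`, `(1,1)` or `(0,2)`. [folklore] -/
theorem finsupp_fin_two_of_degree_two {d : Fin 2 →₀ ℕ} (hd : d.degree = 2) :
    d = Finsupp.single 0 2 ∨ d = Finsupp.single 0 1 + Finsupp.single 1 1 ∨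
      d = Finsupp.single 1 2 := by
  rw [Finsupp.degree_eq_sum, Fin.sum_univ_two] at hd
  rcases Nat.lt_or_ge (d 0) 1 with h | h
  · right; right
    refine Finsupp.ext fun i => ?_
    fin_cases i <;> simp <;> omega
  · rcases Nat.lt_or_ge (d 0) 2 with h' | h'
    · right; left
      refine Finsupp.ext fun i => ?_
      fin_cases i <;> simp <;> omega
    · left
      refine Finsupp.ext fun i => ?_
      fin_cases i <;> simp <;> omega

/-- **A quadratic form in one variable**: `Q(z) = p z₀²` with `p = coeff_{X₀²} Q`. [folklore] -/
theorem aeval_eq_of_isHomogeneous_two_one (Q : MvPolynomial (Fin 1) ℚ) (hQ : Q.IsHomogeneous 2)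
    (z : Fin 1 → ℂ) :
    aeval z Q = ((Q.coeff (Finsupp.single 0 2) : ℚ) : ℂ) * z 0 ^ 2 := by
  classical
  rw [aeval_eq_sum_support]
  have hsub : Q.support ⊆ {Finsupp.single 0 2} := fun d hd =>
    Finset.mem_singleton.mpr (finsupp_fin_one_of_degree_two (degree_eq_two_of_mem_support hQ hd))
  rw [Finset.sum_subset hsub (fun d _ hd => by simp [notMem_support_iff.mp hd]),
    Finset.sum_singleton]
  simp

/-- **A binary quadratic form**: `Q(z) = p z₀² + q z₀z₁ + r z₁²` with `p, q, r` the coefficients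
of `X₀², X₀X₁, X₁²`. [folklore] -/
theorem aeval_eq_of_isHomogeneous_two_two (Q : MvPolynomial (Fin 2) ℚ) (hQ : Q.IsHomogeneous 2)
    (z : Fin 2 → ℂ) :
    aeval z Q = ((Q.coeff (Finsupp.single 0 2) : ℚ) : ℂ) * z 0 ^ 2 +
      ((Q.coeff (Finsupp.single 0 1 + Finsupp.single 1 1) : ℚ) : ℂ) * (z 0 * z 1) +
      ((Q.coeff (Finsupp.single 1 2) : ℚ) : ℂ) * z 1 ^ 2 := by
  classical
  rw [aeval_eq_sum_support]
  set d₁ : Fin 2 →₀ ℕ := Finsupp.single 0 2 with hd₁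
  set d₂ : Fin 2 →₀ ℕ := Finsupp.single 0 1 + Finsupp.single 1 1 with hd₂
  set d₃ : Fin 2 →₀ ℕ := Finsupp.single 1 2 with hd₃
  have h12 : d₁ ≠ d₂ := fun h => by
    have := DFunLike.congr_fun h 0
    simp [hd₁, hd₂] at this
  have h13 : d₁ ≠ d₃ := fun h => by
    have := DFunLike.congr_fun h 0
    simp [hd₁, hd₃] at this
  have h23 : d₂ ≠ d₃ := fun h => by
    have := DFunLike.congr_fun h 0
    simp [hd₂, hd₃] at this
  have hsub : Q.support ⊆ {d₁, d₂, d₃} := by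
    intro d hd
    rcases finsupp_fin_two_of_degree_two (degree_eq_two_of_mem_support hQ hd) with h | h | h <;>
      simp [h, hd₁, hd₂, hd₃]
  rw [Finset.sum_subset hsub (fun d _ hd => by simp [notMem_support_iff.mp hd]),
    Finset.sum_insert (by simp [h12, h13]), Finset.sum_insert (by simp [h23]),
    Finset.sum_singleton]
  simp [hd₁, hd₂, hd₃, Fin.prod_univ_two]
  ring

/-- **Every quadratic form in at most two variables over `ℚ` splits over `ℚ̄`**: there are
algebraic `aᵢ, bᵢ` with `Q(z) = (∑ aᵢzᵢ)(∑ bᵢzᵢ)` on `ℂⁿ` (`n ≤ 2`). For `n = 2` and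
`Q = pX₀² + qX₀X₁ + rX₁²`: if `p = 0` then `Q = X₁(qX₀ + rX₁)`; if `p ≠ 0` then
`4pQ = (2pX₀ + (q − s)X₁)(2pX₀ + (q + s)X₁)` with `s² = q² − 4pr`. [folklore] -/
theorem exists_split_of_le_two (hn : n ≤ 2) (Q : MvPolynomial (Fin n) ℚ)
    (hQ : Q.IsHomogeneous 2) :
    ∃ a b : Fin n → ℂ, (∀ i, IsAlgebraic ℚ (a i)) ∧ (∀ i, IsAlgebraic ℚ (b i)) ∧
      ∀ z : Fin n → ℂ, aeval z Q = (∑ i, a i * z i) * (∑ i, b i * z i) := by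
  have hrat : ∀ x : ℚ, IsAlgebraic ℚ (x : ℂ) := fun x => by
    simpa using isAlgebraic_algebraMap (R := ℚ) (A := ℂ) x
  obtain rfl | rfl | rfl : n = 0 ∨ n = 1 ∨ n = 2 := by omega
  · -- no variables: `Q = 0`
    refine ⟨0, 0, fun i => i.elim0, fun i => i.elim0, fun z => ?_⟩
    rw [eq_zero_of_isHomogeneous_two_zero Q hQ]
    simp
  · -- one variable: `Q = p X₀² = (p X₀) · X₀`
    refine ⟨![((Q.coeff (Finsupp.single 0 2) : ℚ) : ℂ)], ![1], ?_, ?_, fun z => ?_⟩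
    · intro i; fin_cases i; simpa using hrat _
    · intro i; fin_cases i; simpa using isAlgebraic_one
    · rw [aeval_eq_of_isHomogeneous_two_one Q hQ]
      simp
      ring
  · -- two variables
    set p : ℚ := Q.coeff (Finsupp.single 0 2) with hp
    set q : ℚ := Q.coeff (Finsupp.single 0 1 + Finsupp.single 1 1) with hq
    set r : ℚ := Q.coeff (Finsupp.single 1 2) with hr
    have hQz : ∀ z : Fin 2 → ℂ,
        aeval z Q = (p : ℂ) * z 0 ^ 2 + (q : ℂ) * (z 0 * z 1) + (r : ℂ) * z 1 ^ 2 :=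
      aeval_eq_of_isHomogeneous_two_two Q hQ
    by_cases hp0 : p = 0
    · -- `Q = X₁ (q X₀ + r X₁)`
      refine ⟨![0, 1], ![(q : ℂ), (r : ℂ)], ?_, ?_, fun z => ?_⟩
      · intro i; fin_cases i
        · simpa using isAlgebraic_zero
        · simpa using isAlgebraic_one
      · intro i; fin_cases i <;> simpa using hrat _
      · rw [hQz z, hp0]
        simp [Fin.sum_univ_two]
        ring
    · -- `4pQ = (2pX₀ + (q − s)X₁)(2pX₀ + (q + s)X₁)`, `s² = q² − 4pr`
      obtain ⟨s, hs⟩ := IsAlgClosed.exists_pow_nat_eq ((q : ℂ) ^ 2 - 4 * p * r) two_pos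
      have hsalg : IsAlgebraic ℚ s := by
        refine IsAlgebraic.of_pow two_pos ?_
        rw [hs]
        have h := hrat (q ^ 2 - 4 * p * r)
        push_cast at h
        exact h
      have hpC : (p : ℂ) ≠ 0 := by exact_mod_cast hp0
      -- `c = 1/(4p)`
      set c : ℂ := (((4 * p)⁻¹ : ℚ) : ℂ) with hc_def
      have hc : 4 * (p : ℂ) * c = 1 := by
        rw [hc_def]
        push_cast
        field_simp
      -- algebraicity through the intermediate field `ℚ̄`
      have hsK : s ∈ algebraicClosure ℚ ℂ := mem_algebraicClosure_iff.2 hsalg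
      have hK : ∀ x : ℚ, (x : ℂ) ∈ algebraicClosure ℚ ℂ := fun x =>
        mem_algebraicClosure_iff.2 (hrat x)
      have hcK : c ∈ algebraicClosure ℚ ℂ := hK _
      refine ⟨![2 * (p : ℂ), (q : ℂ) - s], ![2 * (p : ℂ) * c, ((q : ℂ) + s) * c], ?_, ?_,
        fun z => ?_⟩
      · intro i; fin_cases i
        · simpa using hrat (2 * p)
        · simpa using mem_algebraicClosure_iff.1 (sub_mem (hK q) hsK)
      · intro i; fin_cases i
        · have h2p : (2 : ℂ) * p ∈ algebraicClosure ℚ ℂ := by simpa using hK (2 * p)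
          simpa using mem_algebraicClosure_iff.1 (mul_mem h2p hcK)
        · simpa using mem_algebraicClosure_iff.1 (mul_mem (add_mem (hK q) hsK) hcK)
      · rw [hQz z]
        simp only [Fin.sum_univ_two, Matrix.cons_val_zero, Matrix.cons_val_one]
        linear_combination (-((p : ℂ) * z 0 ^ 2 + (q : ℂ) * (z 0 * z 1) + (r : ℂ) * z 1 ^ 2)) * hc +
          c * (z 1) ^ 2 * hs

/-- **The Résumé corollary for `n ≤ 2`, unconditionally** (Baker; for `n = 2` the
Gelfond–Schneider theorem in the form "`β₁ log α₁ + β₂ log α₂ ≠ 0`", Baker 1975, Ch. 2 §1): if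
`λ : Fin n → ℂ`, `n ≤ 2`, has `ℚ`-linearly independent coordinates that are logarithms of
algebraic numbers, then `Q(λ) ≠ 0` for every non-zero quadratic form `Q ∈ ℚ[X]`.
[cite: Baker1975, Thm 2.1 and Ch. 2 §1] [cite: RoyWaldschmidt1997ENS, Résumé p. 753] -/
theorem quadraticForm_ne_zero_of_le_two (hn : n ≤ 2) (l : Fin n → ℂ)
    (hl : ∀ i, IsAlgebraic ℚ (cexp (l i))) (hli : LinearIndependent ℚ l)
    (Q : MvPolynomial (Fin n) ℚ) (hQ : Q.IsHomogeneous 2) (hQ0 : Q ≠ 0) :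
    aeval l Q ≠ 0 := by
  obtain ⟨a, b, ha, hb, hab⟩ := exists_split_of_le_two hn Q hQ
  exact aeval_ne_zero_of_split hl hli hQ0 ha hb hab

/-- **The instance `n ≤ 2` of the named fact
`royWaldschmidt_quadraticForm_ne_zero_of_trdeg_one`** (its transcendence-degree hypothesis is not
used). [cite: RoyWaldschmidt1997ENS, Résumé p. 753] [cite: Baker1975, Thm 2.1] -/
theorem royWaldschmidt_quadraticForm_ne_zero_of_trdeg_one_of_le_two (hn : n ≤ 2)
    (l : Fin n → ℂ) (hl : ∀ i, IsAlgebraic ℚ (cexp (l i))) (hli : LinearIndependent ℚ l)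
    (_htr : Algebra.trdeg ℚ ↥(IntermediateField.adjoin ℚ (Set.range l)) = 1)
    (Q : MvPolynomial (Fin n) ℚ) (hQ : Q.IsHomogeneous 2) (hQ0 : Q ≠ 0) :
    aeval l Q ≠ 0 :=
  quadraticForm_ne_zero_of_le_two hn l hl hli Q hQ hQ0

end RoyWaldschmidt1997

end Literature.NumberTheory.Transcendental
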